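import Mathlib
import Literature.Barriers.PneNP.ExtendedFormulationLinearImage
import Literature.Barriers.PneNP.ExtendedFormulationCalculus
import Literature.Barriers.PneNP.ExtendedFormulationMinkowskiFaces
import Summits.ValiantsHypothesis.ValiantsHypothesis.Cruxes.NNLinearDegreeCofactorHard.Lines.xc_division
import HarnessLib

/-!
# The COR-absorbing NORMAL FORM of a cheap pair — kernel pieces, REV 3 (val-idea-40 g2, crux stmt-ValiantsHypothesis-21181,
lens «Minkowski-summand structure (which Q survive)», card `summand-normal-form`)

The open core of the line of record `Lines/virtual_passenger.lean` (rev 8) is STUB C `GadgetSaturatedBudgetedLaw`: the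
COR-virtual law `xc(conv q) ≤ r ∧ xc(COR(K_h) + conv q) ≤ r ⇒ r > T c h` restricted to passenger FAMILIES `q` outside seven
decided classes A⁺ B D E F G H (gadget-blind, sparse-diff, dim-deficient, block-blind, common-extremiser, diag-face-poor,
rooted-extremisers).  The classes are predicates of the PRESENTATION `q`; the pair `(Q, COR + Q)` is not.

**The move.**  The set of cheap pairs is closed under Minkowski moves that keep `COR` absorbed: from a pair with both budgets `≤ r`
pass to the NORMAL FORM family
  `nf q (b, k, l) := corVec ⊤ b + 2 • q k − E_{ll}`,   `conv (nf q) = COR + 2·conv q − Δ_diag`,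
whose two budgets are `≤ 2r + h` and `≤ r + h` (`nf_budget`, `nf_sum_budget`, UNCONDITIONAL `nf_pair_budget'`: `COR + conv(nf q) =
2·(COR + conv q) − Δ_diag` is a linear image plus a simplex; REV 2 proves slack-form subadditivity `hasEFOfSize_add` —
`xc(P + Q) ≤ xc P + xc Q`, previously in the tree only for pointed EFs — by the product system on `ι ⊕ ι` + `image_linearMap`).
REV 3 (§4) types the card's point (ii): LOCATED FACES ARE MOVE-STABLE — `locatedFace_nf`: for valid bounds `δ` on `R = COR + conv q`
and `ε` on `−Δ_diag`, `face_c(COR + conv nf q) = 2 • face_c(R) + face_c(−Δ_diag)` (Schneider 1.7.5 (c)), and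
`locatedFace_nf_generic`: for `c` with a unique diagonal minimum at `l₀` it is the TRANSLATE `2 • face_c(R) + {−E_{l₀l₀}}`;
`hasEFOfSize_locatedFace_nf`: these faces inherit the pair's budget.  **Theorem (`core_meets_every_orbit`).**  For EVERY `q` (decided or not) and every `h` with
`1 ≤ lvl h` the family `nf q` violates ALL SEVEN class predicates.  Hence stub C, as typed, contains a budget-`(2r+h)` presentation
of every cheap pair: no further `by_cases` on presentation predicates can shrink it, and C is the full COR-virtual law up to the
substitution `r ↦ 2r + h` (which the threshold `T c h` absorbs).  What survives the move is only MOVE-INVARIANT data: the located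
faces of `R = COR + Q` and their EF sizes — the card proposes to re-type the partition on those (see the card's `Transfer:`).

Provenance: class predicates copied VERBATIM from `Lines/virtual_passenger.lean` rev 8 §3 (that module is not built on the farm,
`lean check` of an importing file returns rc 75 `unbuilt`); once it builds, `example : VirtualPassenger.GadgetBlind = GadgetBlind := rfl`
etc. identify the copies.  Everything below is `sorry`-free unless marked.
-/

set_option linter.dupNamespace false

namespace Summit.ValiantsHypothesis.ValiantsHypothesis.Cruxes.NNDivisionHard.ValIdea40.NormalForm

open scoped Pointwise
open Matrix Finset
open Literature.Barriers.PneNP (HasEFOfSize HasPointedEFOfSize hasPointedEFOfSize_convexHull_finset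
  add_inter_dotProduct_eq_of_valid convexHull_inter_dotProduct_eq_of_valid)
open Literature.Combinatorics.Optimization (corPolytopeGraph corVec)
open Summit.ValiantsHypothesis.ValiantsHypothesis.Cruxes.NNLinearDegreeCofactorHard.XcDivision
  (udRow udMat udInd udInd_apply diagDir uSlot wSlot corVec_top_apply)

/-! ## §0 Verbatim copies of the seven class predicates and of stub C (line `virtual_passenger` rev 8 §3) -/

/-- the route's quasi-polynomial threshold `T c n = 2^((log₂ n + c)^c)`. -/
abbrev T (c n : ℕ) : ℕ := 2 ^ ((Nat.log 2 n + c) ^ c)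

/-- the read level at scale `h`. -/
def lvl (h : ℕ) : ℕ := Nat.sqrt h - 2

/-- `W_ι` (line §2, `Gadget.gadgetSpan`). -/
def gadgetSpan {m n : ℕ} (ι : Fin m ⊕ (Fin m × Fin m) ↪ Fin n) : Submodule ℝ (Fin n × Fin n → ℝ) :=
  Submodule.span ℝ (Set.range fun b : {b : Fin n → Bool //
      ∀ g : Fin m × Fin m, b (wSlot ι g) = (b (uSlot ι g.1) && b (uSlot ι g.2))} =>
    corVec (⊤ : SimpleGraph (Fin n)) b.1)

/-- index support of a direction (line `Gadget.indexSupport`). -/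
noncomputable def indexSupport {h : ℕ} (d : Fin h × Fin h → ℝ) : Finset (Fin h) :=
  Finset.univ.filter fun z => ∃ z', d (z, z') ≠ 0 ∨ d (z', z) ≠ 0

/-- symmetric and β-block-constant (line `Blocks38.BlockConstSymGen`). -/
def BlockConstSymGen {n m : ℕ} (β : Fin n → Fin m) (g : Fin n × Fin n → ℝ) : Prop :=
  (∀ p q, g (p, q) = g (q, p)) ∧ ∀ p q p' q', β p = β p' → β q = β q' → g (p, q) = g (p', q')

/-- the all-ones direction (line `Blocks38.Jdir`). -/
def Jdir (n : ℕ) : Fin n × Fin n → ℝ := fun _ => 1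

/-- CLASS A⁺ (verbatim). -/
def GadgetBlind (h : ℕ) {J : Type} (q : J → (Fin h × Fin h → ℝ)) : Prop :=
  ∃ ι : Fin (lvl h + 1) ⊕ (Fin (lvl h + 1) × Fin (lvl h + 1)) ↪ Fin h,
    ∀ j j', q j - q j' ∈ gadgetSpan ι → ∀ g : Fin (lvl h + 1) × Fin (lvl h + 1), g.1 ≠ g.2 →
      (q j - q j') (wSlot ι g, wSlot ι g) = 0

/-- CLASS B (verbatim). -/
def SparseDiff (h : ℕ) {J : Type} (q : J → (Fin h × Fin h → ℝ)) : Prop :=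
  ∀ j j', (indexSupport (q j - q j')).card ≤ Nat.log 2 (Nat.log 2 h)

/-- CLASS D (verbatim). -/
def DimDeficient (h : ℕ) {J : Type} (q : J → (Fin h × Fin h → ℝ)) : Prop :=
  Module.finrank ℝ ↥(vectorSpan ℝ (Set.range q)) + lvl h ≤ h

/-- CLASS E (verbatim). -/
def BlockBlind (h : ℕ) {J : Type} (q : J → (Fin h × Fin h → ℝ)) : Prop :=
  ∃ (β : Fin h → Fin (lvl h + 1)) (ρ : Fin (lvl h + 1) → Fin h), (∀ t, β (ρ t) = t) ∧
    ∀ j j', BlockConstSymGen β (q j - q j') → ∃ α : ℝ, q j - q j' = α • Jdir h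

/-- the clique row in the graph currency (verbatim). -/
noncomputable def udRowG {h : ℕ} (a : Finset (Fin h)) : Fin h × Fin h → ℝ :=
  fun ij => Summit.ValiantsHypothesis.ValiantsHypothesis.Cruxes.NNLinearDegreeCofactorHard.XcDivision.udRow a
    (finProdFinEquiv ij)

/-- CLASS F (verbatim). -/
def CommonExtremiser (h : ℕ) {J : Type} (q : J → (Fin h × Fin h → ℝ)) : Prop :=
  ∃ j₀, ∀ (a : Finset (Fin h)) (j : J), udRowG a ⬝ᵥ q j ≤ udRowG a ⬝ᵥ q j₀

/-- the signed diagonal direction (verbatim). -/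
noncomputable def diagDirG {h : ℕ} (S S' : Finset (Fin h)) : Fin h × Fin h → ℝ :=
  fun ij => Summit.ValiantsHypothesis.ValiantsHypothesis.Cruxes.NNLinearDegreeCofactorHard.XcDivision.diagDir S S' (finProdFinEquiv ij)

theorem diagDirG_apply {h : ℕ} (S S' : Finset (Fin h)) (i j : Fin h) :
    diagDirG S S' (i, j) = if i = j then (if i ∈ S then (1 : ℝ) else if i ∈ S' then -1 else 0) else 0 := by
  unfold diagDirG Summit.ValiantsHypothesis.ValiantsHypothesis.Cruxes.NNLinearDegreeCofactorHard.XcDivision.diagDir Literature.Combinatorics.Optimization.FixedSizePsdRank.flat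
  simp only [Equiv.symm_apply_apply, Matrix.diagonal_apply]

/-- CLASS G (verbatim). -/
def DiagFacePoor (h : ℕ) {J : Type} (q : J → (Fin h × Fin h → ℝ)) : Prop :=
  ∃ (S S' : Finset (Fin h)) (s : Finset (Fin h × Fin h → ℝ)), Disjoint S S' ∧
    (∀ j, (∀ j', diagDirG S S' ⬝ᵥ q j' ≤ diagDirG S S' ⬝ᵥ q j) → q j ∈ s) ∧
    s.card * 3 ^ lvl h * 2 ^ (h - (S.card + S'.card)) ≤ 3 ^ (h - (S.card + S'.card)) * 2 ^ lvl h

/-- CLASS H (verbatim). -/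
def RootedExtremisers (h : ℕ) {J : Type} (q : J → (Fin h × Fin h → ℝ)) : Prop :=
  ∀ b : Finset (Fin h), ∃ j₀ : J, ∀ a : Finset (Fin h), (a ∩ b).card = 1 → ∀ j : J,
    udRowG a ⬝ᵥ q j ≤ udRowG a ⬝ᵥ q j₀

/-- STUB C of the line (verbatim): the open core. -/
def GadgetSaturatedBudgetedLaw : Prop :=
  ∀ c : ℕ, ∃ h₀ : ℕ, ∀ h ≥ h₀, ∀ (K : ℕ) (q : Fin (K + 1) → (Fin h × Fin h → ℝ)) (r : ℕ),
    ¬ GadgetBlind h q → ¬ DimDeficient h q → ¬ BlockBlind h q → ¬ SparseDiff h q → ¬ CommonExtremiser h q →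
    ¬ DiagFacePoor h q → ¬ RootedExtremisers h q → HasEFOfSize (convexHull ℝ (Set.range q)) r →
    HasEFOfSize (corPolytopeGraph (⊤ : SimpleGraph (Fin h)) + convexHull ℝ (Set.range q)) r → T c h < r

/-- COR-VIRTUAL law of the line (verbatim, `VPLine.CorVirtualHard`). -/
def CorVirtualHard : Prop :=
  ∀ c : ℕ, ∃ h₀ : ℕ, ∀ h ≥ h₀, ∀ (K : ℕ) (q : Fin (K + 1) → (Fin h × Fin h → ℝ)) (r : ℕ),
    HasEFOfSize (convexHull ℝ (Set.range q)) r →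
    HasEFOfSize (corPolytopeGraph (⊤ : SimpleGraph (Fin h)) + convexHull ℝ (Set.range q)) r → T c h < r

/-- `xc(P + Q) ≤ xc P + xc Q` for arbitrary slack-form EFs (the tree had it only for pointed EFs,
`HasPointedEFOfSize.hasEFOfSize_add`); PROVED below as `xcSubadditive` (rev 2: product system + `image_linearMap`), kept as a
named Prop so the budget lemmas can be quoted either way. -/
def XcSubadditive : Prop :=
  ∀ (ι : Type) [Fintype ι] (P Q : Set (ι → ℝ)) (r s : ℕ), HasEFOfSize P r → HasEFOfSize Q s → HasEFOfSize (P + Q) (r + s)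

/-! ### §0b `xc(P + Q) ≤ xc P + xc Q` for slack-form EFs (PROVED: product system on `ι ⊕ ι` + `image_linearMap`) -/

section Subadditive

variable {ι : Type} [Fintype ι]

/-- **Minkowski sums are subadditive in slack-form EF size**: the block-diagonal product system on `ι ⊕ ι`
has `r + s` sign-constrained variables (`hasEFOfSize_of_system`), and `P + Q` is its image under the linear map
`z ↦ z ∘ inl + z ∘ inr` (`HasEFOfSize.image_linearMap`, no additive loss). [folklore; HrubesYehudayoff2021 L.34 for pointed EFs] -/
theorem hasEFOfSize_add {P₁ P₂ : Set (ι → ℝ)} {r s : ℕ} (h₁ : HasEFOfSize P₁ r) (h₂ : HasEFOfSize P₂ s) :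
    HasEFOfSize (P₁ + P₂) (r + s) := by
  classical
  obtain ⟨Q₁, hQ₁⟩ := h₁
  obtain ⟨Q₂, hQ₂⟩ := h₂
  let PQ : Set (ι ⊕ ι → ℝ) := {z | ∃ y : Fin r ⊕ Fin s → ℝ, (∀ j, 0 ≤ y j) ∧
      Matrix.fromBlocks Q₁.E 0 0 Q₂.E *ᵥ z + Matrix.fromBlocks Q₁.F 0 0 Q₂.F *ᵥ y = Sum.elim Q₁.g Q₂.g}
  have hPQ : HasEFOfSize PQ (r + s) := by
    have := Literature.Barriers.PneNP.hasEFOfSize_of_system (ι := ι ⊕ ι)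
      (Matrix.fromBlocks Q₁.E 0 0 Q₂.E) (Matrix.fromBlocks Q₁.F 0 0 Q₂.F) (Sum.elim Q₁.g Q₂.g)
    simpa [PQ, Fintype.card_sum, Fintype.card_fin] using this
  let L : (ι ⊕ ι → ℝ) →ₗ[ℝ] (ι → ℝ) := LinearMap.funLeft ℝ ℝ Sum.inl + LinearMap.funLeft ℝ ℝ Sum.inr
  have hL : ∀ z : ι ⊕ ι → ℝ, L z = z ∘ Sum.inl + z ∘ Sum.inr := fun z => by
    funext i; simp [L, LinearMap.funLeft_apply]
  have himg : L '' PQ = P₁ + P₂ := by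
    ext x
    constructor
    · rintro ⟨z, ⟨y, hy, hsys⟩, rfl⟩
      have e₁ : Q₁.E *ᵥ (z ∘ Sum.inl) + Q₁.F *ᵥ (y ∘ Sum.inl) = Q₁.g := by
        funext i; have := congrFun hsys (Sum.inl i); simpa [Matrix.fromBlocks_mulVec] using this
      have e₂ : Q₂.E *ᵥ (z ∘ Sum.inr) + Q₂.F *ᵥ (y ∘ Sum.inr) = Q₂.g := by
        funext i; have := congrFun hsys (Sum.inr i); simpa [Matrix.fromBlocks_mulVec] using this
      refine Set.mem_add.2 ⟨z ∘ Sum.inl, ?_, z ∘ Sum.inr, ?_, (hL z).symm⟩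
      · rw [← hQ₁]; exact ⟨y ∘ Sum.inl, fun j => hy _, e₁⟩
      · rw [← hQ₂]; exact ⟨y ∘ Sum.inr, fun j => hy _, e₂⟩
    · intro hx
      obtain ⟨x₁, hx₁, x₂, hx₂, rfl⟩ := Set.mem_add.1 hx
      rw [← hQ₁] at hx₁
      rw [← hQ₂] at hx₂
      obtain ⟨y₁, hy₁, e₁⟩ := hx₁
      obtain ⟨y₂, hy₂, e₂⟩ := hx₂
      refine ⟨Sum.elim x₁ x₂, ⟨Sum.elim y₁ y₂, ?_, ?_⟩, ?_⟩
      · rintro (j | j)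
        · simpa using hy₁ j
        · simpa using hy₂ j
      · funext i
        rcases i with i | i
        · have := congrFun e₁ i; simpa [Matrix.fromBlocks_mulVec] using this
        · have := congrFun e₂ i; simpa [Matrix.fromBlocks_mulVec] using this
      · rw [hL]; funext i; simp
  rw [← himg]
  exact hPQ.image_linearMap L

end Subadditive

/-- the named fact is a THEOREM (rev 2). -/
theorem xcSubadditive : XcSubadditive := fun _ _ _ _ _ _ hP hQ => hasEFOfSize_add hP hQ

/-! ## §1 The normal form -/

variable {h K : ℕ}

/-- the diagonal vertex `E_{ll}`. -/
def dvx (l : Fin h) : Fin h × Fin h → ℝ := Pi.single (l, l) 1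

/-- **the NORMAL-FORM family** of a passenger family `q`: `nf q (b, k, l) = bbᵀ + 2 q_k − E_{ll}`. -/
def nf (q : Fin (K + 1) → (Fin h × Fin h → ℝ)) : (Fin h → Bool) × Fin (K + 1) × Fin h → (Fin h × Fin h → ℝ) :=
  fun j => corVec (⊤ : SimpleGraph (Fin h)) j.1 + (2 : ℝ) • q j.2.1 - dvx j.2.2

/-- the diagonal simplex `Δ_diag = conv{E_ll}`. -/
def diagSimplex (h : ℕ) : Set (Fin h × Fin h → ℝ) := convexHull ℝ (Set.range (dvx (h := h)))

theorem nf_apply (q : Fin (K + 1) → (Fin h × Fin h → ℝ)) (b : Fin h → Bool) (k : Fin (K + 1)) (l : Fin h)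
    (p : Fin h × Fin h) : nf q (b, k, l) p = corVec ⊤ b p + 2 * q k p - dvx l p := by
  simp [nf, smul_eq_mul]

theorem dvx_apply (l : Fin h) (p : Fin h × Fin h) : dvx l p = if p = (l, l) then 1 else 0 := by
  simp [dvx, Pi.single_apply]

/-- same `(k, l)`: the normal-form difference is the COR difference. -/
theorem nf_sub_nf (q : Fin (K + 1) → (Fin h × Fin h → ℝ)) (b b' : Fin h → Bool) (k : Fin (K + 1)) (l : Fin h) :
    nf q (b, k, l) - nf q (b', k, l) = corVec ⊤ b - corVec ⊤ b' := by
  simp only [nf]; abel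

theorem corVec_false : corVec (⊤ : SimpleGraph (Fin h)) (fun _ => false) = 0 := by
  funext ⟨p, p'⟩; rw [corVec_top_apply]; simp

theorem corVec_true_apply (p : Fin h × Fin h) : corVec (⊤ : SimpleGraph (Fin h)) (fun _ => true) p = 1 := by
  obtain ⟨p, p'⟩ := p; rw [corVec_top_apply]; simp

theorem corVec_single (i : Fin h) :
    corVec (⊤ : SimpleGraph (Fin h)) (fun p => decide (p = i)) = Pi.single (i, i) 1 := by
  funext ⟨p, p'⟩
  rw [corVec_top_apply, Pi.single_apply]
  by_cases hp : p = i <;> by_cases hp' : p' = i <;> simp [hp, hp']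

/-! ### §1a Minkowski algebra and the two budgets -/

theorem range_nf (q : Fin (K + 1) → (Fin h × Fin h → ℝ)) :
    Set.range (nf q) = Set.range (corVec (⊤ : SimpleGraph (Fin h))) +
      (Set.range (fun k => (2 : ℝ) • q k) + Set.range (fun l : Fin h => -dvx l)) := by
  ext x
  constructor
  · rintro ⟨⟨b, k, l⟩, rfl⟩
    exact Set.mem_add.2 ⟨_, ⟨b, rfl⟩, _, Set.mem_add.2 ⟨_, ⟨k, rfl⟩, _, ⟨l, rfl⟩, rfl⟩, by simp only [nf]; abel⟩
  · intro hx
    obtain ⟨_, ⟨b, rfl⟩, _, h2, rfl⟩ := Set.mem_add.1 hx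
    obtain ⟨_, ⟨k, rfl⟩, _, ⟨l, rfl⟩, rfl⟩ := Set.mem_add.1 h2
    exact ⟨(b, k, l), by simp only [nf]; abel⟩

theorem convexHull_range_nf (q : Fin (K + 1) → (Fin h × Fin h → ℝ)) :
    convexHull ℝ (Set.range (nf q)) =
      corPolytopeGraph (⊤ : SimpleGraph (Fin h)) + ((2 : ℝ) • convexHull ℝ (Set.range q) + -diagSimplex h) := by
  rw [range_nf, convexHull_add, convexHull_add]
  have h1 : Set.range (fun k => (2 : ℝ) • q k) = (2 : ℝ) • Set.range q := by
    ext x; simp [Set.mem_smul_set]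
  have h2 : Set.range (fun l : Fin h => -dvx l) = -Set.range (dvx (h := h)) := by
    ext x; simp only [Set.mem_range, Set.mem_neg]
    constructor
    · rintro ⟨l, rfl⟩; exact ⟨l, by simp⟩
    · rintro ⟨l, hl⟩; exact ⟨l, by rw [hl, neg_neg]⟩
  rw [h1, h2, convexHull_smul, convexHull_neg]
  rfl

/-- `2 • S` is the image of `S` under the linear map `2 • id`. -/
theorem two_smul_eq_image (S : Set (Fin h × Fin h → ℝ)) :
    (2 : ℝ) • S = ((2 : ℝ) • (LinearMap.id : (Fin h × Fin h → ℝ) →ₗ[ℝ] (Fin h × Fin h → ℝ))) '' S := by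
  ext x; simp [Set.mem_smul_set]

theorem convex_add_self {S : Set (Fin h × Fin h → ℝ)} (hS : Convex ℝ S) : S + S = (2 : ℝ) • S := by
  have := hS.add_smul (p := 1) (q := 1) zero_le_one zero_le_one
  rw [one_smul, one_add_one_eq_two] at this
  exact this.symm

/-- **SUM BUDGET**: `COR + conv(nf q) = 2·(COR + conv q) − Δ_diag`, so `xc ≤ r + h`. -/
theorem cor_add_convexHull_nf (q : Fin (K + 1) → (Fin h × Fin h → ℝ)) :
    corPolytopeGraph (⊤ : SimpleGraph (Fin h)) + convexHull ℝ (Set.range (nf q)) =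
      (2 : ℝ) • (corPolytopeGraph (⊤ : SimpleGraph (Fin h)) + convexHull ℝ (Set.range q)) + -diagSimplex h := by
  have hC : (2 : ℝ) • corPolytopeGraph (⊤ : SimpleGraph (Fin h)) = corPolytopeGraph ⊤ + corPolytopeGraph ⊤ :=
    (convex_add_self (convex_convexHull ℝ _)).symm
  rw [convexHull_range_nf, smul_add, hC]
  simp only [add_assoc]

theorem hasEFOfSize_neg_diagSimplex : HasEFOfSize (-diagSimplex h) h := by
  classical
  have hfin : -diagSimplex h = convexHull ℝ ((Finset.univ.image fun l : Fin h => -dvx l : Finset _) : Set _) := by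
    rw [Finset.coe_image, Finset.coe_univ, Set.image_univ, diagSimplex, ← convexHull_neg]
    congr 1
    ext x; simp only [Set.mem_range, Set.mem_neg]
    constructor
    · rintro ⟨l, hl⟩; exact ⟨l, by rw [hl, neg_neg]⟩
    · rintro ⟨l, rfl⟩; exact ⟨l, by simp⟩
  rw [hfin]
  refine (hasPointedEFOfSize_convexHull_finset _).hasEFOfSize.of_le ?_
  exact (Finset.card_image_le).trans (by simp)

theorem nf_sum_budget (q : Fin (K + 1) → (Fin h × Fin h → ℝ)) {r : ℕ} (hadd : XcSubadditive)
    (hR : HasEFOfSize (corPolytopeGraph (⊤ : SimpleGraph (Fin h)) + convexHull ℝ (Set.range q)) r) :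
    HasEFOfSize (corPolytopeGraph (⊤ : SimpleGraph (Fin h)) + convexHull ℝ (Set.range (nf q))) (r + h) := by
  rw [cor_add_convexHull_nf, two_smul_eq_image]
  exact hadd _ _ _ _ _ (hR.image_linearMap _) hasEFOfSize_neg_diagSimplex

/-- **PASSENGER BUDGET**: `conv(nf q) = (COR + conv q) + conv q − Δ_diag`, so `xc ≤ r + r + h`. -/
theorem nf_budget (q : Fin (K + 1) → (Fin h × Fin h → ℝ)) {r : ℕ} (hadd : XcSubadditive)
    (hQ : HasEFOfSize (convexHull ℝ (Set.range q)) r)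
    (hR : HasEFOfSize (corPolytopeGraph (⊤ : SimpleGraph (Fin h)) + convexHull ℝ (Set.range q)) r) :
    HasEFOfSize (convexHull ℝ (Set.range (nf q))) (r + r + h) := by
  have e : convexHull ℝ (Set.range (nf q)) =
      (corPolytopeGraph (⊤ : SimpleGraph (Fin h)) + convexHull ℝ (Set.range q)) + convexHull ℝ (Set.range q) +
        -diagSimplex h := by
    have hX : (2 : ℝ) • convexHull ℝ (Set.range q) = convexHull ℝ (Set.range q) + convexHull ℝ (Set.range q) :=
      (convex_add_self (convex_convexHull ℝ _)).symm
    rw [convexHull_range_nf, hX]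
    simp only [add_assoc]
  rw [e]
  exact hadd _ _ _ _ _ (hadd _ _ _ _ _ hR hQ) hasEFOfSize_neg_diagSimplex

/-! ### §1b Row values on the normal form -/

theorem udRowG_apply (a : Finset (Fin h)) (i j : Fin h) :
    udRowG a (i, j) = 2 * (if i = j then 1 else 0) * udInd a i - udInd a i * udInd a j := by
  unfold udRowG Summit.ValiantsHypothesis.ValiantsHypothesis.Cruxes.NNLinearDegreeCofactorHard.XcDivision.udRow
    Literature.Combinatorics.Optimization.FixedSizePsdRank.flat
    Summit.ValiantsHypothesis.ValiantsHypothesis.Cruxes.NNLinearDegreeCofactorHard.XcDivision.udMat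
  simp only [Equiv.symm_apply_apply]

/-- the singleton clique row is the coordinate functional `x ↦ x (i, i)`. -/
theorem udRowG_singleton (i : Fin h) : udRowG ({i} : Finset (Fin h)) = Pi.single (i, i) 1 := by
  funext ⟨p, p'⟩
  rw [udRowG_apply, udInd_apply, udInd_apply, Pi.single_apply]
  simp only [Finset.mem_singleton, Prod.mk.injEq]
  by_cases hp : p = i
  · subst hp
    by_cases hp' : p' = p
    · subst hp'; norm_num
    · simp [hp', Ne.symm hp']
  · simp [hp]

theorem udRowG_singleton_dotProduct (i : Fin h) (x : Fin h × Fin h → ℝ) :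
    udRowG ({i} : Finset (Fin h)) ⬝ᵥ x = x (i, i) := by
  rw [udRowG_singleton, single_dotProduct, one_mul]

/-- **the `E_{ll}` coordinate is seen by the singleton row `{l}`**: moving `l` away gains exactly `1`. -/
theorem row_gain (q : Fin (K + 1) → (Fin h × Fin h → ℝ)) (b : Fin h → Bool) (k : Fin (K + 1)) {l l' : Fin h}
    (hl : l' ≠ l) :
    udRowG ({l} : Finset (Fin h)) ⬝ᵥ nf q (b, k, l') = udRowG ({l} : Finset (Fin h)) ⬝ᵥ nf q (b, k, l) + 1 := by
  rw [udRowG_singleton_dotProduct, udRowG_singleton_dotProduct, nf_apply, nf_apply, dvx_apply, dvx_apply]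
  have h1 : ¬ ((l, l) = (l', l')) := by simp [hl.symm]
  simp [h1]

/-! ## §2 The normal form violates every class predicate -/

section Classes

variable (q : Fin (K + 1) → (Fin h × Fin h → ℝ))

/-- ¬ CLASS F: no common extremiser (the `E_{ll}` coordinate of `j₀` can always be improved on row `{l}`). -/
theorem not_commonExtremiser_nf (hh : 2 ≤ h) : ¬ CommonExtremiser h (nf q) := by
  rintro ⟨⟨b₀, k₀, l₀⟩, hj₀⟩
  obtain ⟨l', hl'⟩ : ∃ l' : Fin h, l' ≠ l₀ := by
    by_cases h0 : (l₀ : ℕ) = 0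
    · exact ⟨⟨1, by omega⟩, fun e => by simp [Fin.ext_iff, h0] at e⟩
    · exact ⟨⟨0, by omega⟩, fun e => by simp [Fin.ext_iff] at e; omega⟩
  have := hj₀ {l₀} (b₀, k₀, l')
  rw [row_gain q b₀ k₀ hl'] at this
  linarith

/-- ¬ CLASS H: at `b = univ` the rooted rows are the singletons, and row `{l₀}` defeats any candidate `j₀ = (b₀, k₀, l₀)`. -/
theorem not_rootedExtremisers_nf (hh : 2 ≤ h) : ¬ RootedExtremisers h (nf q) := by
  intro hH
  obtain ⟨⟨b₀, k₀, l₀⟩, hj₀⟩ := hH Finset.univ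
  obtain ⟨l', hl'⟩ : ∃ l' : Fin h, l' ≠ l₀ := by
    by_cases h0 : (l₀ : ℕ) = 0
    · exact ⟨⟨1, by omega⟩, fun e => by simp [Fin.ext_iff, h0] at e⟩
    · exact ⟨⟨0, by omega⟩, fun e => by simp [Fin.ext_iff] at e; omega⟩
  have := hj₀ {l₀} (by simp) (b₀, k₀, l')
  rw [row_gain q b₀ k₀ hl'] at this
  linarith

/-- ¬ CLASS B: the difference `𝟙𝟙ᵀ − 0` touches every index. -/
theorem not_sparseDiff_nf (hh : 1 ≤ h) : ¬ SparseDiff h (nf q) := by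
  intro hB
  have l₀ : Fin h := ⟨0, by omega⟩
  have hd := hB ((fun _ => true), 0, l₀) ((fun _ => false), 0, l₀)
  rw [nf_sub_nf, corVec_false, sub_zero] at hd
  have hsupp : indexSupport (corVec (⊤ : SimpleGraph (Fin h)) fun _ => true) = Finset.univ := by
    apply Finset.eq_univ_of_forall
    intro z
    simp only [indexSupport, Finset.mem_filter, Finset.mem_univ, true_and]
    exact ⟨z, Or.inl (by rw [corVec_true_apply]; norm_num)⟩
  rw [hsupp, Finset.card_univ, Fintype.card_fin] at hd
  have h1 : Nat.log 2 (Nat.log 2 h) < h :=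
    (Nat.log_le_self 2 _).trans_lt (Nat.log_lt_self 2 (by omega))
  omega

/-- ¬ CLASS A⁺: for EVERY placement `ι`, the consistent difference `𝟙𝟙ᵀ − 0 ∈ W_ι` has a live AND-diagonal. -/
theorem not_gadgetBlind_nf (hl : 1 ≤ lvl h) (hh : 1 ≤ h) : ¬ GadgetBlind h (nf q) := by
  rintro ⟨ι, hι⟩
  have l₀ : Fin h := ⟨0, by omega⟩
  have hd := hι ((fun _ => true), 0, l₀) ((fun _ => false), 0, l₀)
  rw [nf_sub_nf, corVec_false, sub_zero] at hd
  have hmem : corVec (⊤ : SimpleGraph (Fin h)) (fun _ => true) ∈ gadgetSpan ι :=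
    Submodule.subset_span ⟨⟨fun _ => true, fun g => by simp⟩, rfl⟩
  have h01 : (⟨0, by omega⟩ : Fin (lvl h + 1)) ≠ ⟨1, by omega⟩ := by simp [Fin.ext_iff]
  have := hd hmem (⟨0, by omega⟩, ⟨1, by omega⟩) h01
  rw [corVec_true_apply] at this
  norm_num at this

/-- ¬ CLASS E: for EVERY sectioned block map `β`, the indicator of block `0` gives a symmetric block-constant difference
that is `1` on block `0` and `0` on block `1`, hence not a multiple of `J`. -/
theorem not_blockBlind_nf (hl : 1 ≤ lvl h) (hh : 1 ≤ h) : ¬ BlockBlind h (nf q) := by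
  rintro ⟨β, ρ, hρ, hE⟩
  have l₀ : Fin h := ⟨0, by omega⟩
  set t₀ : Fin (lvl h + 1) := ⟨0, by omega⟩ with ht₀
  set t₁ : Fin (lvl h + 1) := ⟨1, by omega⟩ with ht₁
  have h01 : t₀ ≠ t₁ := by simp [ht₀, ht₁, Fin.ext_iff]
  let bβ : Fin h → Bool := fun p => decide (β p = t₀)
  have hd := hE (bβ, 0, l₀) ((fun _ => false), 0, l₀)
  rw [nf_sub_nf, corVec_false, sub_zero] at hd
  have hgen : BlockConstSymGen β (corVec (⊤ : SimpleGraph (Fin h)) bβ) := by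
    refine ⟨fun p p' => ?_, fun p p' p'' p''' hp hq => ?_⟩
    · rw [corVec_top_apply, corVec_top_apply, mul_comm]
    · rw [corVec_top_apply, corVec_top_apply]
      simp [bβ, hp, hq]
  obtain ⟨α, hα⟩ := hd hgen
  have e0 := congrFun hα (ρ t₀, ρ t₀)
  have e1 := congrFun hα (ρ t₁, ρ t₁)
  rw [corVec_top_apply] at e0 e1
  simp [bβ, hρ, Jdir, h01.symm] at e0 e1
  linarith

/-- ¬ CLASS D: the vector span contains every `E_{ii} = corVec 𝟙_{{i}} − corVec 0`, so `dim ≥ h > h − lvl h`. -/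
theorem not_dimDeficient_nf (hl : 1 ≤ lvl h) (hh : 1 ≤ h) : ¬ DimDeficient h (nf q) := by
  intro hD
  unfold DimDeficient at hD
  have l₀ : Fin h := ⟨0, by omega⟩
  set V := vectorSpan ℝ (Set.range (nf q)) with hV
  have hmem : ∀ i : Fin h, (Pi.single (i, i) (1 : ℝ) : Fin h × Fin h → ℝ) ∈ V := by
    intro i
    have := vsub_mem_vectorSpan ℝ (Set.mem_range_self (f := nf q) ((fun p => decide (p = i)), 0, l₀))
      (Set.mem_range_self (f := nf q) ((fun _ => false), 0, l₀))
    rwa [vsub_eq_sub, nf_sub_nf, corVec_false, sub_zero, corVec_single] at this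
  let f : Fin h → V := fun i => ⟨Pi.single (i, i) 1, hmem i⟩
  have hf : LinearIndependent ℝ f := by
    apply LinearIndependent.of_comp V.subtype
    have e : (V.subtype ∘ f) = fun i : Fin h => (Pi.basisFun ℝ (Fin h × Fin h)) ((fun i => (i, i)) i) := by
      funext i; simp [f, Pi.basisFun_apply]
    rw [e]
    exact (Pi.basisFun ℝ (Fin h × Fin h)).linearIndependent.comp (fun i : Fin h => (i, i))
      (fun i j hij => (Prod.mk.inj hij).1)
  have hcard := hf.fintype_card_le_finrank
  rw [Fintype.card_fin] at hcard
  omega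

/-! ### ¬ CLASS G: the face of `conv(nf q)` in direction `E_S − E_{S'}` carries `2^{h−|S|−|S'|}` distinct points -/

theorem diagDirG_dotProduct_eq (S S' : Finset (Fin h)) (x : Fin h × Fin h → ℝ) :
    diagDirG S S' ⬝ᵥ x = ∑ i, (if i ∈ S then (1 : ℝ) else if i ∈ S' then -1 else 0) * x (i, i) := by
  unfold dotProduct
  rw [Fintype.sum_prod_type]
  refine Finset.sum_congr rfl fun i _ => ?_
  simp only [diagDirG_apply, ite_mul, zero_mul, Finset.sum_ite_eq, Finset.mem_univ, if_true]

theorem diagDirG_dotProduct_corVec_le (S S' : Finset (Fin h)) (b : Fin h → Bool) :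
    diagDirG S S' ⬝ᵥ corVec (⊤ : SimpleGraph (Fin h)) b ≤ S.card := by
  rw [diagDirG_dotProduct_eq]
  calc ∑ i, (if i ∈ S then (1 : ℝ) else if i ∈ S' then -1 else 0) * corVec ⊤ b (i, i)
      ≤ ∑ i, (if i ∈ S then (1 : ℝ) else 0) := Finset.sum_le_sum fun i _ => by
        rw [corVec_top_apply]
        by_cases h1 : i ∈ S <;> by_cases h2 : i ∈ S' <;> cases b i <;> simp [h1, h2]
    _ = S.card := by simp

/-- the indicator of `S ∪ T`. -/
def bT (S T : Finset (Fin h)) : Fin h → Bool := fun p => decide (p ∈ S ∪ T)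

theorem diagDirG_dotProduct_corVec_bT {S S' : Finset (Fin h)} (T : Finset (Fin h)) (hT : T ⊆ (S ∪ S')ᶜ) :
    diagDirG S S' ⬝ᵥ corVec (⊤ : SimpleGraph (Fin h)) (bT S T) = S.card := by
  rw [diagDirG_dotProduct_eq]
  calc ∑ i, (if i ∈ S then (1 : ℝ) else if i ∈ S' then -1 else 0) * corVec ⊤ (bT S T) (i, i)
      = ∑ i, (if i ∈ S then (1 : ℝ) else 0) := Finset.sum_congr rfl fun i _ => by
        rw [corVec_top_apply]
        by_cases h1 : i ∈ S
        · simp [bT, h1]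
        · by_cases h2 : i ∈ S'
          · have hiT : i ∉ T := fun hi => by
              have := Finset.mem_compl.1 (hT hi)
              exact this (Finset.mem_union_right _ h2)
            simp [bT, h1, h2, hiT]
          · simp [h1, h2]
    _ = S.card := by simp

theorem diagDirG_dotProduct_nf (S S' : Finset (Fin h)) (b : Fin h → Bool) (k : Fin (K + 1)) (l : Fin h) :
    diagDirG S S' ⬝ᵥ nf q (b, k, l) =
      diagDirG S S' ⬝ᵥ corVec ⊤ b + 2 * (diagDirG S S' ⬝ᵥ q k) - diagDirG S S' ⬝ᵥ dvx l := by
  simp only [nf, dotProduct_sub, dotProduct_add, dotProduct_smul, smul_eq_mul]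

theorem bT_injective {S S' : Finset (Fin h)} {T₁ T₂ : Finset (Fin h)} (h₁ : T₁ ⊆ (S ∪ S')ᶜ) (h₂ : T₂ ⊆ (S ∪ S')ᶜ)
    (e : corVec (⊤ : SimpleGraph (Fin h)) (bT S T₁) = corVec ⊤ (bT S T₂)) : T₁ = T₂ := by
  ext i
  have ei := congrFun e (i, i)
  rw [corVec_top_apply, corVec_top_apply] at ei
  by_cases hS : i ∈ S
  · have n1 : i ∉ T₁ := fun hi => (Finset.mem_compl.1 (h₁ hi)) (Finset.mem_union_left _ hS)
    have n2 : i ∉ T₂ := fun hi => (Finset.mem_compl.1 (h₂ hi)) (Finset.mem_union_left _ hS)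
    simp [n1, n2]
  · by_cases a1 : i ∈ T₁ <;> by_cases a2 : i ∈ T₂ <;> simp [bT, hS, a1, a2] at ei ⊢

/-- ¬ CLASS G. -/
theorem not_diagFacePoor_nf (hl : 1 ≤ lvl h) (hh : 1 ≤ h) : ¬ DiagFacePoor h (nf q) := by
  classical
  rintro ⟨S, S', s, hdisj, hs, hle⟩
  haveI : Nonempty (Fin h) := ⟨⟨0, by omega⟩⟩
  -- maximise the `q`-part and the `−E_{ll}`-part separately
  obtain ⟨kS, -, hkS⟩ := Finset.exists_max_image Finset.univ (fun k => diagDirG S S' ⬝ᵥ q k) Finset.univ_nonempty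
  obtain ⟨lS, -, hlS⟩ := Finset.exists_max_image Finset.univ (fun l : Fin h => -(diagDirG S S' ⬝ᵥ dvx l))
    Finset.univ_nonempty
  set m := h - (S.card + S'.card) with hm
  let F : Finset (Fin h) → (Fin h × Fin h → ℝ) := fun T => nf q (bT S T, kS, lS)
  -- every `F T`, `T ⊆ (S ∪ S')ᶜ`, maximises `E_S − E_{S'}` over the family
  have hmax : ∀ T, T ⊆ (S ∪ S')ᶜ → ∀ j', diagDirG S S' ⬝ᵥ nf q j' ≤ diagDirG S S' ⬝ᵥ F T := by
    intro T hT j'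
    obtain ⟨b', k', l'⟩ := j'
    show diagDirG S S' ⬝ᵥ nf q (b', k', l') ≤ diagDirG S S' ⬝ᵥ nf q (bT S T, kS, lS)
    rw [diagDirG_dotProduct_nf, diagDirG_dotProduct_nf, diagDirG_dotProduct_corVec_bT T hT]
    have a1 := diagDirG_dotProduct_corVec_le S S' b'
    have a2 := hkS k' (Finset.mem_univ _)
    have a3 := hlS l' (Finset.mem_univ _)
    beta_reduce at a2 a3
    linarith
  have hsub : ((S ∪ S')ᶜ.powerset.image F) ⊆ s := by
    intro x hx
    obtain ⟨T, hT, rfl⟩ := Finset.mem_image.1 hx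
    exact hs _ (hmax T (Finset.mem_powerset.1 hT))
  have hinj : Set.InjOn F ↑((S ∪ S')ᶜ.powerset) := by
    intro T₁ h₁ T₂ h₂ hF
    have h₁' := Finset.mem_powerset.1 (Finset.mem_coe.1 h₁)
    have h₂' := Finset.mem_powerset.1 (Finset.mem_coe.1 h₂)
    apply bT_injective h₁' h₂'
    have := sub_eq_zero.2 hF
    rw [show F T₁ - F T₂ = nf q (bT S T₁, kS, lS) - nf q (bT S T₂, kS, lS) from rfl, nf_sub_nf] at this
    exact sub_eq_zero.1 this
  have hcard : ((S ∪ S')ᶜ.powerset.image F).card = 2 ^ m := by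
    rw [Finset.card_image_of_injOn hinj, Finset.card_powerset, Finset.card_compl, Fintype.card_fin,
      Finset.card_union_of_disjoint hdisj]
  have h2m : 2 ^ m ≤ s.card := hcard ▸ Finset.card_le_card hsub
  -- arithmetic: `3^m · 2^L < 4^m · 3^L ≤ #s · 3^L · 2^m`
  have h23 : 2 ^ lvl h < 3 ^ lvl h := Nat.pow_lt_pow_left (by norm_num) (by omega)
  have h34 : 3 ^ m ≤ 2 ^ m * 2 ^ m := by
    calc 3 ^ m ≤ 4 ^ m := Nat.pow_le_pow_left (by norm_num) m
      _ = 2 ^ m * 2 ^ m := by rw [show (4 : ℕ) = 2 * 2 from rfl, mul_pow]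
  have hA : 3 ^ m * 2 ^ lvl h < 3 ^ m * 3 ^ lvl h := Nat.mul_lt_mul_of_pos_left h23 (by positivity)
  have hB : 3 ^ m * 3 ^ lvl h ≤ (2 ^ m * 2 ^ m) * 3 ^ lvl h := Nat.mul_le_mul_right _ h34
  have hC : (2 ^ m * 2 ^ m) * 3 ^ lvl h ≤ s.card * 3 ^ lvl h * 2 ^ m := by
    calc (2 ^ m * 2 ^ m) * 3 ^ lvl h = 2 ^ m * 3 ^ lvl h * 2 ^ m := by ring
      _ ≤ s.card * 3 ^ lvl h * 2 ^ m := by gcongr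
  exact absurd (hA.trans_le (hB.trans hC)) (not_lt.2 hle)

/-- ★ **THE CORE MEETS EVERY ORBIT.**  For every passenger family `q` whatsoever and every scale with `1 ≤ lvl h`
(i.e. `h ≥ 9`), the normal form `nf q` satisfies ALL SEVEN hypotheses `¬A⁺ ¬D ¬E ¬B ¬F ¬G ¬H` of stub C. -/
theorem core_meets_every_orbit (hl : 1 ≤ lvl h) :
    ¬ GadgetBlind h (nf q) ∧ ¬ DimDeficient h (nf q) ∧ ¬ BlockBlind h (nf q) ∧ ¬ SparseDiff h (nf q) ∧
      ¬ CommonExtremiser h (nf q) ∧ ¬ DiagFacePoor h (nf q) ∧ ¬ RootedExtremisers h (nf q) := by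
  have hh : 2 ≤ h := by
    unfold lvl at hl
    have := Nat.sqrt_le_self h
    omega
  exact ⟨not_gadgetBlind_nf q hl (by omega), not_dimDeficient_nf q hl (by omega), not_blockBlind_nf q hl (by omega),
    not_sparseDiff_nf q (by omega), not_commonExtremiser_nf q hh, not_diagFacePoor_nf q hl (by omega),
    not_rootedExtremisers_nf q hh⟩

end Classes

/-! ## §3 Consequence: stub C is the whole COR-virtual law up to `r ↦ 2r + h`

Re-indexing `(Fin h → Bool) × Fin (K+1) × Fin h ≃ Fin (K'+1)` is routine and omitted; the statement below records the
substitution in the family currency of the normal form. -/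

/-- the COR-virtual law stated on normal-form families only (index type of `nf`). -/
def CorVirtualHardNF : Prop :=
  ∀ c : ℕ, ∃ h₀ : ℕ, ∀ h ≥ h₀, ∀ (K : ℕ) (q : Fin (K + 1) → (Fin h × Fin h → ℝ)) (r : ℕ),
    HasEFOfSize (convexHull ℝ (Set.range (nf q))) r →
    HasEFOfSize (corPolytopeGraph (⊤ : SimpleGraph (Fin h)) + convexHull ℝ (Set.range (nf q))) r → T c h < r

/-- **budget transport**: a cheap pair `(conv q, COR + conv q)` at budget `r` yields the normal-form pair at budget `2r + h`
(uses the named fact `XcSubadditive`). -/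
theorem nf_pair_budget (hadd : XcSubadditive) {h K r : ℕ} (q : Fin (K + 1) → (Fin h × Fin h → ℝ))
    (hQ : HasEFOfSize (convexHull ℝ (Set.range q)) r)
    (hR : HasEFOfSize (corPolytopeGraph (⊤ : SimpleGraph (Fin h)) + convexHull ℝ (Set.range q)) r) :
    HasEFOfSize (convexHull ℝ (Set.range (nf q))) (2 * r + h) ∧
      HasEFOfSize (corPolytopeGraph (⊤ : SimpleGraph (Fin h)) + convexHull ℝ (Set.range (nf q))) (2 * r + h) :=
  ⟨by simpa [two_mul] using nf_budget q hadd hQ hR, (nf_sum_budget q hadd hR).of_le (by omega)⟩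

/-- ★ **UNCONDITIONAL budget transport** (rev 2): every cheap pair at budget `r` has its normal form cheap at budget `2r + h`. -/
theorem nf_pair_budget' {h K r : ℕ} (q : Fin (K + 1) → (Fin h × Fin h → ℝ))
    (hQ : HasEFOfSize (convexHull ℝ (Set.range q)) r)
    (hR : HasEFOfSize (corPolytopeGraph (⊤ : SimpleGraph (Fin h)) + convexHull ℝ (Set.range q)) r) :
    HasEFOfSize (convexHull ℝ (Set.range (nf q))) (2 * r + h) ∧
      HasEFOfSize (corPolytopeGraph (⊤ : SimpleGraph (Fin h)) + convexHull ℝ (Set.range (nf q))) (2 * r + h) :=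
  nf_pair_budget xcSubadditive q hQ hR


/-! ## §4 LOCATED FACES ARE MOVE-STABLE (rev 3): `face_c(COR + conv nf q) = 2 • face_c(COR + conv q) + face_c(−Δ_diag)`

The support sets (located faces, tree format `S ∩ {c ⬝ᵥ x = δ}` with `δ` valid) of the normal-form sum are — up to the
scaling `×2` and a face of the diagonal simplex (a single vertex `−E_{ll}` when the diagonal of `c` has a unique minimum) — exactly
the support sets of `R = COR + conv q`.  This is the positive half of the card's point (ii): located-face data of a cheap pair
survive the COR-absorbing moves, passenger-extremiser data do not. -/

section LocatedFaces

variable {h K : ℕ}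

/-- scaling a support set: `(2 • S) ∩ {c ⬝ z = 2δ} = 2 • (S ∩ {c ⬝ x = δ})`. -/
theorem two_smul_inter_dotProduct (S : Set (Fin h × Fin h → ℝ)) (c : Fin h × Fin h → ℝ) (δ : ℝ) :
    ((2 : ℝ) • S) ∩ {z | c ⬝ᵥ z = 2 * δ} = (2 : ℝ) • (S ∩ {x | c ⬝ᵥ x = δ}) := by
  ext z
  simp only [Set.mem_inter_iff, Set.mem_smul_set, Set.mem_setOf_eq]
  constructor
  · rintro ⟨⟨x, hx, rfl⟩, hz⟩
    refine ⟨x, ⟨hx, ?_⟩, rfl⟩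
    rw [dotProduct_smul, smul_eq_mul] at hz
    linarith
  · rintro ⟨x, ⟨hx, hcx⟩, rfl⟩
    refine ⟨⟨x, hx, rfl⟩, ?_⟩
    rw [dotProduct_smul, smul_eq_mul, hcx]

/-- a valid bound on `R` doubles to a valid bound on `2 • R`. -/
theorem valid_two_smul {S : Set (Fin h × Fin h → ℝ)} {c : Fin h × Fin h → ℝ} {δ : ℝ}
    (hδ : ∀ x ∈ S, c ⬝ᵥ x ≤ δ) : ∀ z ∈ (2 : ℝ) • S, c ⬝ᵥ z ≤ 2 * δ := by
  rintro _ ⟨x, hx, rfl⟩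
  rw [dotProduct_smul, smul_eq_mul]
  have := hδ x hx
  linarith

/-- ★ **LOCATED FACES OF THE NORMAL-FORM SUM**: for a functional `c` with valid bound `δ` on `R = COR + conv q` and valid bound
`ε` on `−Δ_diag`, the support set of `R' = COR + conv(nf q)` at level `2δ + ε` is `2 • face_c(R) + face_c(−Δ_diag)`.
[Schneider1993 Thm 1.7.5 (c) via `add_inter_dotProduct_eq_of_valid`] -/
theorem locatedFace_nf (q : Fin (K + 1) → (Fin h × Fin h → ℝ)) (c : Fin h × Fin h → ℝ) (δ ε : ℝ)
    (hδ : ∀ x ∈ corPolytopeGraph (⊤ : SimpleGraph (Fin h)) + convexHull ℝ (Set.range q), c ⬝ᵥ x ≤ δ)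
    (hε : ∀ y ∈ -diagSimplex h, c ⬝ᵥ y ≤ ε) :
    (corPolytopeGraph (⊤ : SimpleGraph (Fin h)) + convexHull ℝ (Set.range (nf q))) ∩ {z | c ⬝ᵥ z = 2 * δ + ε} =
      (2 : ℝ) • ((corPolytopeGraph (⊤ : SimpleGraph (Fin h)) + convexHull ℝ (Set.range q)) ∩ {x | c ⬝ᵥ x = δ})
        + (-diagSimplex h ∩ {y | c ⬝ᵥ y = ε}) := by
  rw [cor_add_convexHull_nf, add_inter_dotProduct_eq_of_valid _ _ c (2 * δ) ε (valid_two_smul hδ) hε,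
    two_smul_inter_dotProduct]

/-- hence the located face `2 • face_c(R) + face_c(−Δ)` inherits the budget of the normal-form sum (faces of EFs are EFs). -/
theorem hasEFOfSize_locatedFace_nf (q : Fin (K + 1) → (Fin h × Fin h → ℝ)) (c : Fin h × Fin h → ℝ) (δ ε : ℝ) {r : ℕ}
    (hδ : ∀ x ∈ corPolytopeGraph (⊤ : SimpleGraph (Fin h)) + convexHull ℝ (Set.range q), c ⬝ᵥ x ≤ δ)
    (hε : ∀ y ∈ -diagSimplex h, c ⬝ᵥ y ≤ ε)
    (hR' : HasEFOfSize (corPolytopeGraph (⊤ : SimpleGraph (Fin h)) + convexHull ℝ (Set.range (nf q))) r) :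
    HasEFOfSize ((2 : ℝ) • ((corPolytopeGraph (⊤ : SimpleGraph (Fin h)) + convexHull ℝ (Set.range q)) ∩ {x | c ⬝ᵥ x = δ})
        + (-diagSimplex h ∩ {y | c ⬝ᵥ y = ε})) r := by
  rw [← locatedFace_nf q c δ ε hδ hε]
  exact hR'.inter_eq c (2 * δ + ε)

/-- `−Δ_diag` as the convex hull of the finite vertex set `{−E_{ll}}`. -/
theorem neg_diagSimplex_eq [DecidableEq (Fin h × Fin h → ℝ)] :
    -diagSimplex h = convexHull ℝ ((Finset.univ.image fun l : Fin h => -dvx l : Finset _) : Set _) := by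
  rw [Finset.coe_image, Finset.coe_univ, Set.image_univ, diagSimplex, ← convexHull_neg]
  congr 1
  ext x; simp only [Set.mem_range, Set.mem_neg]
  constructor
  · rintro ⟨l, hl⟩; exact ⟨l, by rw [hl, neg_neg]⟩
  · rintro ⟨l, rfl⟩; exact ⟨l, by simp⟩

theorem dotProduct_neg_dvx (c : Fin h × Fin h → ℝ) (l : Fin h) : c ⬝ᵥ (-dvx l) = -c (l, l) := by
  rw [dotProduct_neg, dvx, dotProduct_single, mul_one]

/-- for `c` whose diagonal has a UNIQUE minimum at `l₀`, the face of `−Δ_diag` in direction `c` is the single vertex `−E_{l₀l₀}`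
(so the located face of the normal-form sum is a TRANSLATE of `2 • face_c(R)`). -/
theorem neg_diagSimplex_face_singleton (c : Fin h × Fin h → ℝ) (l₀ : Fin h)
    (hmin : ∀ l, l ≠ l₀ → c (l₀, l₀) < c (l, l)) :
    -diagSimplex h ∩ {y | c ⬝ᵥ y = -c (l₀, l₀)} = {-dvx l₀} := by
  classical
  have hvalid : ∀ s ∈ (Finset.univ.image fun l : Fin h => -dvx l), c ⬝ᵥ s ≤ -c (l₀, l₀) := by
    intro s hs
    obtain ⟨l, -, rfl⟩ := Finset.mem_image.1 hs
    rw [dotProduct_neg_dvx]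
    by_cases hl : l = l₀
    · rw [hl]
    · have := hmin l hl; linarith
  rw [neg_diagSimplex_eq, convexHull_inter_dotProduct_eq_of_valid _ c _ hvalid]
  have hfilter : ((Finset.univ.image fun l : Fin h => -dvx l).filter fun s => c ⬝ᵥ s = -c (l₀, l₀)) = {-dvx l₀} := by
    ext s
    simp only [Finset.mem_filter, Finset.mem_image, Finset.mem_univ, true_and, Finset.mem_singleton]
    constructor
    · rintro ⟨⟨l, rfl⟩, hs⟩
      rw [dotProduct_neg_dvx] at hs
      by_cases hl : l = l₀
      · rw [hl]
      · have := hmin l hl; linarith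
    · rintro rfl
      exact ⟨⟨l₀, rfl⟩, dotProduct_neg_dvx c l₀⟩
  rw [hfilter, Finset.coe_singleton, convexHull_singleton]

/-- ★ corollary: for diagonal-generic `c` the located face of the normal-form sum is the translate `2 • face_c(R) + {−E_{l₀l₀}}`. -/
theorem locatedFace_nf_generic (q : Fin (K + 1) → (Fin h × Fin h → ℝ)) (c : Fin h × Fin h → ℝ) (δ : ℝ) (l₀ : Fin h)
    (hδ : ∀ x ∈ corPolytopeGraph (⊤ : SimpleGraph (Fin h)) + convexHull ℝ (Set.range q), c ⬝ᵥ x ≤ δ)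
    (hmin : ∀ l, l ≠ l₀ → c (l₀, l₀) < c (l, l)) :
    (corPolytopeGraph (⊤ : SimpleGraph (Fin h)) + convexHull ℝ (Set.range (nf q))) ∩ {z | c ⬝ᵥ z = 2 * δ + -c (l₀, l₀)} =
      (2 : ℝ) • ((corPolytopeGraph (⊤ : SimpleGraph (Fin h)) + convexHull ℝ (Set.range q)) ∩ {x | c ⬝ᵥ x = δ})
        + {-dvx l₀} := by
  classical
  have hε : ∀ y ∈ -diagSimplex h, c ⬝ᵥ y ≤ -c (l₀, l₀) := by
    intro y hy
    rw [neg_diagSimplex_eq] at hy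
    -- a convex combination of the vertices has value ≤ the max vertex value
    have hvalid : ∀ s ∈ ((Finset.univ.image fun l : Fin h => -dvx l : Finset _) : Set _), c ⬝ᵥ s ≤ -c (l₀, l₀) := by
      intro s hs
      obtain ⟨l, -, rfl⟩ := Finset.mem_image.1 (Finset.mem_coe.1 hs)
      rw [dotProduct_neg_dvx]
      by_cases hl : l = l₀
      · rw [hl]
      · have := hmin l hl; linarith
    have hconv : Convex ℝ {s : Fin h × Fin h → ℝ | c ⬝ᵥ s ≤ -c (l₀, l₀)} := by
      have : {s : Fin h × Fin h → ℝ | c ⬝ᵥ s ≤ -c (l₀, l₀)} = (fun s => c ⬝ᵥ s) ⁻¹' Set.Iic (-c (l₀, l₀)) := rfl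
      rw [this]
      exact (convex_Iic _).linear_preimage (LinearMap.mk₂ ℝ (fun a b : Fin h × Fin h → ℝ => a ⬝ᵥ b)
        (fun a b d => add_dotProduct a b d) (fun r a b => smul_dotProduct r a b)
        (fun a b d => dotProduct_add a b d) (fun r a b => dotProduct_smul r a b) c)
    exact (convexHull_min hvalid hconv) hy
  rw [locatedFace_nf q c δ (-c (l₀, l₀)) hδ hε, neg_diagSimplex_face_singleton c l₀ hmin]

end LocatedFaces

end Summit.ValiantsHypothesis.ValiantsHypothesis.Cruxes.NNDivisionHard.ValIdea40.NormalForm
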